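import Summits.QuantumAdvantage.QuantumAdvantage.Theorems.SymplecticPurityDlogGraphFlatSpreadMain
import Literature.Combinatorics.Additive.BalogSzemerediGowersMultiplicative
import Literature.Combinatorics.Additive.PopularDifferencesIncidence
import Literature.Combinatorics.Additive.SumsetFromPopularDifferences
import Literature.Combinatorics.Additive.IndexEnergy

/-!
# Crux `DlogGraphFlat` (stmt-QuantumAdvantage-10732), line `Sketch` — sector A: the spread-set
# energy bound R4 modulo Stevens–de Zeeuw (`stub_dlogSpreadOfSdZ`)

`stevensDeZeeuw_thm4 → stub_dlogSpreadEnergy`-statement: the multiplicative energy of every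
translate `c + S_b` of the signed-digit spread set is `≤ C · 2^{(3−κ)|b|}`. Route (CORES.md §2):
index energy → set energy (`index_energy_le`, fibres ≤ 2); BSG in `𝔽_pˣ`
(`Zhao2023_thm7136_mul`, PROVED in tree) gives `A' ⊆ A` with `|A'A'| ≤ Q|A'|`, `Q = C₁K^{C₁}`;
Stevens–de Zeeuw (named fact, hypothesis) bounds the popular differences of `A'`
(`popular_difference_le_of_sdz`); Cauchy–Schwarz (`card_mul_card_le_two_mul_card_add`) and the
cube + sub-cube bound (`card_add_spread_le`) feed the real bookkeeping `stub_dlogSpreadMain`, giving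
`|A| ≤ 2^{68} C₂⁴ C₁^{21} K^{21 C₁}`, i.e. `E×(A) ≤ C |A|^{3 − 1/(21 C₁)}`. No new definitions.
-/

set_option linter.dupNamespace false -- D-0017: single-problem summit ⇒ `QuantumAdvantage.QuantumAdvantage` by design

namespace Summit.QuantumAdvantage.QuantumAdvantage.Theorems.SymplecticPurity

open Finset Literature.Computability.QuantumComplexity Literature.Computability.Cryptography
open Literature.Combinatorics.Additive
open scoped Pointwise Combinatorics.Additive

/-- The combinatorial step of R4-mod-SdZ for one admissible block length `m`: popular differences
of `A'` (Stevens–de Zeeuw) + Cauchy–Schwarz + cube/sub-cube sumset give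
`|A'| · 2^m ≤ 4 · 3^m · 2^{k−m}`. -/
theorem spread_comb_step {n p : ℕ} [Fact p.Prime] (hp2 : p ≠ 2) (h2p : 2 ^ n ≤ 2 * p)
    (b : QReg n) (c : ZMod p) (k : ℕ) (hk : (Finset.univ.filter fun j => b j = true).card = k)
    (hb : 2 * k ≤ n) (C₂ C₂' Q Y : ℝ) (hC₂ : 0 < C₂) (hC₂C : C₂ ≤ C₂') (hC₂'1 : 1 ≤ C₂')
    (hQ1 : 1 ≤ Q) (hY1 : 1 ≤ Y)
    (hPD : ∀ A : Finset (ZMod p), (0 : ZMod p) ∉ A → ((A * A).card : ℝ) ≤ (A.card : ℝ) ^ 2 →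
      (ringChar (ZMod p) = 0 ∨
        ((A * A).card : ℝ) * ((A.card : ℝ) * A.card) ≤ 4 * (ringChar (ZMod p) : ℝ) ^ 2) →
      ∀ d : ZMod p, d ≠ 0 →
      ((((A ×ˢ A).filter fun x : ZMod p × ZMod p => x.1 - x.2 = d).card : ℝ) * ((A.card : ℝ) * A.card) ≤
        C₂ * (((A * A).card : ℝ) ^ (5 / 4 : ℝ) * (A.card : ℝ) ^ (3 / 2 : ℝ) + (A.card : ℝ) * A.card)))
    (A' : Finset (ZMod p)) (hA'0 : (0 : ZMod p) ∉ A')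
    (hA'S : A' ⊆ (Finset.univ.image fun u : QReg n => fun j => u j && b j).image
      fun u => c + ((Nat.ofBits b : ZMod p) - 2 * (Nat.ofBits u : ZMod p)))
    (hY4 : Y ^ 4 = A'.card) (hA'N : (A'.card : ℝ) ≤ (2 : ℝ) ^ (k : ℝ))
    (h2' : ((A' * A').card : ℝ) ≤ Q * A'.card)
    (m : ℕ) (hm1 : 1 ≤ m) (hmk : m ≤ k) (hadm : (2 : ℝ) ^ m * (C₂' * (Q ^ 2 * Y ^ 3 + 1)) ≤ Y ^ 4) :
    Y ^ 4 * (2 : ℝ) ^ m ≤ 4 * (3 : ℝ) ^ m * (2 : ℝ) ^ (k - m) := by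
  classical
  have hNR : ((2 ^ k : ℕ) : ℝ) = (2 : ℝ) ^ (k : ℝ) := by rw [Real.rpow_natCast]; push_cast; ring
  obtain ⟨b'', hsub, hb''⟩ := exists_submask b m (hk ▸ hmk)
  set Ub'' := Finset.univ.image fun u : QReg n => fun j => u j && b'' j with hUb''
  have hUb''c : Ub''.card = 2 ^ m := by rw [hUb'', card_patterns_eq b'', hb'']
  set B := Ub''.image fun u => (Nat.ofBits b'' : ZMod p) - 2 * (Nat.ofBits u : ZMod p) with hB
  have hB2 : Ub''.card ≤ 2 * B.card :=
    Finset.card_le_mul_card_image Ub'' 2 fun y _ => spread_fibre_le_two hp2 h2p b'' _ y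
  have hBle : B.card ≤ 2 ^ m := Finset.card_image_le.trans (le_of_eq hUb''c)
  have h2m2 : (2 : ℝ) ≤ (2 : ℝ) ^ m := by
    calc (2 : ℝ) = 2 ^ 1 := by norm_num
      _ ≤ 2 ^ m := pow_le_pow_right₀ (by norm_num) hm1
  have hQY : Q ≤ Y := adm_Q_le_Y Q Y C₂' ((2 : ℝ) ^ m) hQ1 hY1 hC₂'1 h2m2 hadm
  have hQA' : Q ≤ A'.card := by
    rw [← hY4]
    calc Q ≤ Y := hQY
      _ = Y ^ 1 := (pow_one Y).symm
      _ ≤ Y ^ 4 := pow_le_pow_right₀ hY1 (by norm_num)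
  -- popular differences of A'
  set R : ℕ := ⌊C₂' * (Q ^ 2 * Y ^ 3 + 1)⌋₊ with hRdef
  have hRle : (R : ℝ) ≤ C₂' * (Q ^ 2 * Y ^ 3 + 1) := Nat.floor_le (by positivity)
  have hAA' : ((A' * A').card : ℝ) ≤ (A'.card : ℝ) ^ 2 := by
    calc ((A' * A').card : ℝ) ≤ Q * A'.card := h2'
      _ ≤ A'.card * A'.card := mul_le_mul_of_nonneg_right hQA' (Nat.cast_nonneg _)
      _ = (A'.card : ℝ) ^ 2 := by ring
  have hkk : ((2 : ℝ) ^ (k : ℝ)) ^ 4 ≤ 4 * (p : ℝ) ^ 2 := by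
    rw [← hNR]
    have h22 : 2 ^ (2 * k) ≤ 2 * p := (Nat.pow_le_pow_right (by norm_num) hb).trans h2p
    have : (2 ^ k) ^ 4 ≤ 4 * p ^ 2 := by
      have e1 : (2 ^ k) ^ 4 = (2 ^ (2 * k)) ^ 2 := by ring
      rw [e1]
      calc (2 ^ (2 * k)) ^ 2 ≤ (2 * p) ^ 2 := Nat.pow_le_pow_left h22 2
        _ = 4 * p ^ 2 := by ring
    exact_mod_cast this
  have hA'0' : (0 : ℝ) ≤ A'.card := Nat.cast_nonneg _
  have hchar : ringChar (ZMod p) = 0 ∨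
      ((A' * A').card : ℝ) * ((A'.card : ℝ) * A'.card) ≤ 4 * (ringChar (ZMod p) : ℝ) ^ 2 := by
    right
    rw [ZMod.ringChar_zmod_n]
    have hAA2 : (0 : ℝ) ≤ (A'.card : ℝ) * A'.card := by positivity
    calc ((A' * A').card : ℝ) * ((A'.card : ℝ) * A'.card)
        ≤ (Q * A'.card) * ((A'.card : ℝ) * A'.card) := mul_le_mul_of_nonneg_right h2' hAA2
      _ ≤ (A'.card * A'.card) * ((A'.card : ℝ) * A'.card) :=
          mul_le_mul_of_nonneg_right (mul_le_mul_of_nonneg_right hQA' hA'0') hAA2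
      _ = (A'.card : ℝ) ^ 4 := by ring
      _ ≤ ((2 : ℝ) ^ (k : ℝ)) ^ 4 := pow_le_pow_left₀ hA'0' hA'N 4
      _ ≤ 4 * (p : ℝ) ^ 2 := hkk
  have hR : ∀ d : ZMod p, d ≠ 0 → ((A' ×ˢ A').filter fun z => z.1 - z.2 = d).card ≤ R := by
    intro d hd
    have h := hPD A' hA'0 hAA' hchar d hd
    have e2 : ((A'.card : ℝ) * A'.card) = (A'.card : ℝ) ^ 2 := by ring
    rw [e2] at h
    have hnum := popdiff_numerics (((A' ×ˢ A').filter fun z => z.1 - z.2 = d).card : ℝ)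
      ((A' * A').card : ℝ) (A'.card : ℝ) Q Y C₂ C₂' hY4.symm hY1 hQ1 hC₂.le hC₂C
      (Nat.cast_nonneg _) h2' h
    rw [hRdef]
    exact Nat.le_floor hnum
  have hBR : B.card * R ≤ A'.card := by
    have hB' : (B.card : ℝ) ≤ (2 : ℝ) ^ m := by exact_mod_cast hBle
    have h1 : (B.card : ℝ) * R ≤ (2 : ℝ) ^ m * (C₂' * (Q ^ 2 * Y ^ 3 + 1)) :=
      mul_le_mul hB' hRle (Nat.cast_nonneg _) (by positivity)
    have h2 : (B.card : ℝ) * R ≤ A'.card := by rw [← hY4]; exact h1.trans hadm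
    exact_mod_cast h2
  have hL2 := card_mul_card_le_two_mul_card_add A' B R hR hBR
  have hL3 := card_add_spread_le b b'' hsub c A' hA'S
  rw [card_filter_and_not b b'' hsub, hb'', hk] at hL3
  have hL2R : (A'.card : ℝ) * B.card ≤ 2 * (A' + B).card := by exact_mod_cast hL2
  have hL3R : ((A' + B).card : ℝ) ≤ (3 : ℝ) ^ m * (2 : ℝ) ^ (k - m) := by
    have h := (Nat.cast_le (α := ℝ)).mpr hL3
    rw [Nat.cast_mul, Nat.cast_pow, Nat.cast_pow] at h
    simpa only [Nat.cast_ofNat] using h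
  have hB2R : (2 : ℝ) ^ m ≤ 2 * B.card := by
    have h := (Nat.cast_le (α := ℝ)).mpr hB2
    rw [hUb''c, Nat.cast_pow, Nat.cast_mul] at h
    simpa only [Nat.cast_ofNat] using h
  rw [hY4]
  calc (A'.card : ℝ) * (2 : ℝ) ^ m ≤ A'.card * (2 * B.card) := mul_le_mul_of_nonneg_left hB2R hA'0'
    _ = 2 * (A'.card * B.card) := by ring
    _ ≤ 2 * (2 * (A' + B).card) := mul_le_mul_of_nonneg_left hL2R (by norm_num)
    _ ≤ 2 * (2 * ((3 : ℝ) ^ m * (2 : ℝ) ^ (k - m))) :=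
        mul_le_mul_of_nonneg_left (mul_le_mul_of_nonneg_left hL3R (by norm_num)) (by norm_num)
    _ = 4 * (3 : ℝ) ^ m * (2 : ℝ) ^ (k - m) := by ring

/-- The set-energy bound of R4-mod-SdZ: for a zero-free `A` inside the translated spread set with
`2^k ≤ 2(|A|+1)`, `E×(A) ≤ C₉^{1/e} · 2^{(3 − 1/e)k}`, `e = 21·max(C₁,1)`,
`C₉ = 2^{68} max(C₂,1)⁴ max(C₁,1)^{21}` (BSG constant `C₁`, Stevens–de Zeeuw constant `C₂`). -/
theorem spread_energy_bound {n p : ℕ} [Fact p.Prime] (hp2 : p ≠ 2) (h2p : 2 ^ n ≤ 2 * p)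
    (b : QReg n) (c : ZMod p) (k : ℕ) (hk : (Finset.univ.filter fun j => b j = true).card = k)
    (hb : 2 * k ≤ n) (C₁ C₂ : ℝ) (hC₂ : 0 < C₂)
    (hBSG : ∀ (A : Finset (ZMod p)) (K : ℝ), (0 : ZMod p) ∉ A → A.Nonempty → 1 ≤ K →
      (A.card : ℝ) ^ 3 / K ≤ Finset.mulEnergy A A →
      ∃ A' ⊆ A, (A.card : ℝ) ≤ C₁ * K ^ C₁ * A'.card ∧ ((A' * A').card : ℝ) ≤ C₁ * K ^ C₁ * A'.card)
    (hPD : ∀ A : Finset (ZMod p), (0 : ZMod p) ∉ A → ((A * A).card : ℝ) ≤ (A.card : ℝ) ^ 2 →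
      (ringChar (ZMod p) = 0 ∨
        ((A * A).card : ℝ) * ((A.card : ℝ) * A.card) ≤ 4 * (ringChar (ZMod p) : ℝ) ^ 2) →
      ∀ d : ZMod p, d ≠ 0 →
      ((((A ×ˢ A).filter fun x : ZMod p × ZMod p => x.1 - x.2 = d).card : ℝ) * ((A.card : ℝ) * A.card) ≤
        C₂ * (((A * A).card : ℝ) ^ (5 / 4 : ℝ) * (A.card : ℝ) ^ (3 / 2 : ℝ) + (A.card : ℝ) * A.card)))
    (A : Finset (ZMod p)) (hA0 : (0 : ZMod p) ∉ A)
    (hAS : A ⊆ (Finset.univ.image fun u : QReg n => fun j => u j && b j).image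
      fun u => c + ((Nat.ofBits b : ZMod p) - 2 * (Nat.ofBits u : ZMod p)))
    (hAN : A.card ≤ 2 ^ k) (hkA : 2 ^ k ≤ 2 * (A.card + 1)) :
    (Finset.mulEnergy A A : ℝ) ≤
      (2 ^ 68 * (max C₂ 1) ^ 4 * (max C₁ 1) ^ 21) ^ (1 / (21 * max C₁ 1)) *
        (2 : ℝ) ^ ((3 - 1 / (21 * max C₁ 1)) * (k : ℝ)) := by
  classical
  set C₁' : ℝ := max C₁ 1 with hC₁'
  set C₂' : ℝ := max C₂ 1 with hC₂'
  have hC₁'1 : 1 ≤ C₁' := le_max_right _ _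
  have hC₁C : C₁ ≤ C₁' := le_max_left _ _
  have hC₂'1 : 1 ≤ C₂' := le_max_right _ _
  have hC₂C : C₂ ≤ C₂' := le_max_left _ _
  set e : ℝ := 21 * C₁' with he
  have he0 : 0 < e := by positivity
  set C₉ : ℝ := 2 ^ 68 * C₂' ^ 4 * C₁' ^ 21 with hC₉
  have hC₉1 : 1 ≤ C₉ := by
    have h1 : (1 : ℝ) ≤ C₂' ^ 4 := one_le_pow₀ hC₂'1
    have h2 : (1 : ℝ) ≤ C₁' ^ 21 := one_le_pow₀ hC₁'1
    have h3 : (1 : ℝ) ≤ C₂' ^ 4 * C₁' ^ 21 := one_le_mul_of_one_le_of_one_le h1 h2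
    rw [hC₉]
    calc (1 : ℝ) ≤ 2 ^ 68 * 1 := by norm_num
      _ ≤ 2 ^ 68 * (C₂' ^ 4 * C₁' ^ 21) := mul_le_mul_of_nonneg_left h3 (by norm_num)
      _ = 2 ^ 68 * C₂' ^ 4 * C₁' ^ 21 := by ring
  have h2pos : (0 : ℝ) < 2 := by norm_num
  have hNR : ((2 ^ k : ℕ) : ℝ) = (2 : ℝ) ^ (k : ℝ) := by rw [Real.rpow_natCast]; push_cast; ring
  have hpow_split : ∀ t : ℝ, ((2 : ℝ) ^ (k : ℝ)) ^ t = (2 : ℝ) ^ (t * (k : ℝ)) := by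
    intro t; rw [← Real.rpow_mul h2pos.le]; ring_nf
  by_cases hAne : A.Nonempty
  swap
  · rw [Finset.not_nonempty_iff_eq_empty] at hAne
    rw [hAne, Finset.mulEnergy_empty_left]; push_cast; positivity
  have hAc0 : (0 : ℝ) < A.card := by exact_mod_cast hAne.card_pos
  set E : ℕ := Finset.mulEnergy A A with hEdef
  have hE1 : 0 < E := Finset.mulEnergy_pos hAne hAne
  have hE3 : E ≤ A.card ^ 3 := mulEnergy_le_card_pow_three A hA0
  have hER : (0 : ℝ) < E := by exact_mod_cast hE1
  set K : ℝ := (A.card : ℝ) ^ 3 / E with hKdef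
  have hK1 : 1 ≤ K := by
    rw [hKdef, one_le_div hER]; exact_mod_cast hE3
  have hKE : (A.card : ℝ) ^ 3 / K ≤ E := by
    have : (A.card : ℝ) ^ 3 / K = E := by rw [hKdef]; field_simp
    exact this.le
  obtain ⟨A', hA'A, h1, h2⟩ := hBSG A K hA0 hAne hK1 hKE
  set Q : ℝ := C₁' * K ^ C₁' with hQdef
  have hKC : (1 : ℝ) ≤ K ^ C₁' := Real.one_le_rpow hK1 (by linarith)
  have hQ1 : 1 ≤ Q := by rw [hQdef]; exact one_le_mul_of_one_le_of_one_le hC₁'1 hKC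
  have hCK : C₁ * K ^ C₁ ≤ Q := by
    rw [hQdef]
    exact mul_le_mul hC₁C (Real.rpow_le_rpow_of_exponent_le hK1 hC₁C) (by positivity)
      (by linarith)
  have h1' : (A.card : ℝ) ≤ Q * A'.card :=
    h1.trans (mul_le_mul_of_nonneg_right hCK (Nat.cast_nonneg _))
  have h2' : ((A' * A').card : ℝ) ≤ Q * A'.card :=
    h2.trans (mul_le_mul_of_nonneg_right hCK (Nat.cast_nonneg _))
  have hA'pos : (0 : ℝ) < A'.card := by
    by_contra h0
    push Not at h0
    have : (A'.card : ℝ) = 0 := le_antisymm h0 (Nat.cast_nonneg _)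
    rw [this, mul_zero] at h1'
    linarith
  have hA'1 : (1 : ℝ) ≤ A'.card := by
    have : 0 < A'.card := by exact_mod_cast hA'pos
    exact_mod_cast this
  have hA'0 : (0 : ZMod p) ∉ A' := fun h => hA0 (hA'A h)
  have hA'N : (A'.card : ℝ) ≤ (2 : ℝ) ^ (k : ℝ) := by
    rw [← hNR]; exact_mod_cast (Finset.card_le_card hA'A).trans hAN
  set Y : ℝ := (A'.card : ℝ) ^ (1 / 4 : ℝ) with hYdef
  have hY1 : 1 ≤ Y := Real.one_le_rpow hA'1 (by norm_num)
  have hY4 : Y ^ 4 = A'.card := by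
    rw [hYdef, ← Real.rpow_natCast, ← Real.rpow_mul (Nat.cast_nonneg _)]; norm_num
  have hYk : Y ≤ (2 : ℝ) ^ ((k : ℝ) / 4) := by
    rw [hYdef, show (k : ℝ) / 4 = (k : ℝ) * (1 / 4) by ring, Real.rpow_mul h2pos.le]
    exact Real.rpow_le_rpow (Nat.cast_nonneg _) hA'N (by norm_num)
  have hN : (2 : ℝ) ^ k ≤ 4 * Q * Y ^ 4 := by
    rw [hY4]
    have h3 : ((2 ^ k : ℕ) : ℝ) ≤ 2 * ((A.card : ℝ) + 1) := by exact_mod_cast hkA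
    push_cast at h3
    have hQA : 1 ≤ Q * A'.card := one_le_mul_of_one_le_of_one_le hQ1 hA'1
    linarith
  have hcomb := spread_comb_step hp2 h2p b c k hk hb C₂ C₂' Q Y hC₂ hC₂C hC₂'1 hQ1 hY1 hPD A' hA'0
    (hA'A.trans hAS) hY4 hA'N h2'
  have hmain := stub_dlogSpreadMain C₂' Q Y k hC₂'1 hQ1 hY1 hYk hN hcomb
  -- |A| ≤ C₉ K^e
  have hQ21 : Q ^ 21 = C₁' ^ 21 * K ^ e := by
    rw [hQdef, mul_pow, he, ← Real.rpow_natCast (K ^ C₁') 21, ← Real.rpow_mul (by linarith)]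
    congr 1; ring_nf
  have hAK : (A.card : ℝ) ≤ C₉ * K ^ e := by
    calc (A.card : ℝ) ≤ Q * A'.card := h1'
      _ = Q * Y ^ 4 := by rw [hY4]
      _ ≤ Q * (2 ^ 68 * C₂' ^ 4 * Q ^ 20) := mul_le_mul_of_nonneg_left hmain (by linarith)
      _ = 2 ^ 68 * C₂' ^ 4 * Q ^ 21 := by ring
      _ = C₉ * K ^ e := by rw [hQ21, hC₉]; ring
  have hEn := energy_from_K_bound (A.card : ℝ) (E : ℝ) C₉ e hAc0 hER hC₉1 he0 hAK
  refine hEn.trans (mul_le_mul_of_nonneg_left ?_ (by positivity))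
  rw [← hpow_split]
  exact Real.rpow_le_rpow (Nat.cast_nonneg _) (by rw [← hNR]; exact_mod_cast hAN)
    (by rw [sub_nonneg, div_le_iff₀ he0]; linarith)

/-- **Stub `stub_dlogSpreadOfSdZ`** (sector A, R4 modulo Stevens–de Zeeuw): the Stevens–de Zeeuw
point–line incidence bound implies the spread-set multiplicative energy bound `stub_dlogSpreadEnergy`. -/
theorem stub_dlogSpreadOfSdZ : Literature.Combinatorics.Additive.stevensDeZeeuw_thm4 →
    ∃ κ : ℝ, 0 < κ ∧ ∃ C : ℝ, 0 < C ∧ ∀ (n p : ℕ), p.Prime → 2 ^ n ≤ 2 * p → ∀ b : QReg n,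
      2 * (Finset.univ.filter fun j => b j = true).card ≤ n → ∀ c : ZMod p,
      (((((Finset.univ.image fun u : QReg n => fun j => u j && b j) ×ˢ
            (Finset.univ.image fun u : QReg n => fun j => u j && b j)) ×ˢ
          ((Finset.univ.image fun u : QReg n => fun j => u j && b j) ×ˢ
            (Finset.univ.image fun u : QReg n => fun j => u j && b j))).filter fun q =>
          (c + ((Nat.ofBits b : ZMod p) - 2 * (Nat.ofBits q.1.1 : ZMod p))) *
            (c + ((Nat.ofBits b : ZMod p) - 2 * (Nat.ofBits q.2.2 : ZMod p))) =
          (c + ((Nat.ofBits b : ZMod p) - 2 * (Nat.ofBits q.1.2 : ZMod p))) *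
            (c + ((Nat.ofBits b : ZMod p) - 2 * (Nat.ofBits q.2.1 : ZMod p)))).card : ℝ)
        ≤ C * (2 : ℝ) ^ ((3 - κ) * ((Finset.univ.filter fun j => b j = true).card : ℝ)) := by
  intro hsdz
  obtain ⟨C₁, hC₁, hBSG⟩ := Zhao2023_thm7136_mul
  obtain ⟨C₂, hC₂, hPD⟩ := popular_difference_le_of_sdz hsdz 4 (by norm_num)
  set e : ℝ := 21 * max C₁ 1 with he
  have he0 : 0 < e := by positivity
  have he1 : 1 / e ≤ 1 := by
    rw [div_le_one he0, he]; linarith [le_max_right C₁ 1]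
  set C₉ : ℝ := 2 ^ 68 * (max C₂ 1) ^ 4 * (max C₁ 1) ^ 21 with hC₉
  refine ⟨1 / e, by positivity, 16 * C₉ ^ (1 / e) + 32, by positivity, ?_⟩
  intro n p hp h2p b hb c
  classical
  haveI := Fact.mk hp
  set k := (Finset.univ.filter fun j => b j = true).card with hk
  set Ub := Finset.univ.image fun u : QReg n => fun j => u j && b j with hUb
  have hUbc : Ub.card = 2 ^ k := card_patterns_eq b
  set x : QReg n → ZMod p := fun u => c + ((Nat.ofBits b : ZMod p) - 2 * (Nat.ofBits u : ZMod p))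
    with hx
  set T := ((Ub ×ˢ Ub) ×ˢ (Ub ×ˢ Ub)).filter fun q => x q.1.1 * x q.2.2 = x q.1.2 * x q.2.1 with hT
  change (T.card : ℝ) ≤ (16 * C₉ ^ (1 / e) + 32) * (2 : ℝ) ^ ((3 - 1 / e) * (k : ℝ))
  have h2pos : (0 : ℝ) < 2 := by norm_num
  have hexp0 : (0 : ℝ) ≤ (3 - 1 / e) * (k : ℝ) := mul_nonneg (by linarith) (Nat.cast_nonneg k)
  have hRHS1 : (1 : ℝ) ≤ (2 : ℝ) ^ ((3 - 1 / e) * (k : ℝ)) := Real.one_le_rpow (by norm_num) hexp0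
  have hTtriv : T.card ≤ 2 ^ k * 2 ^ k * (2 ^ k * 2 ^ k) := by
    have := Finset.card_filter_le ((Ub ×ˢ Ub) ×ˢ (Ub ×ˢ Ub))
      (fun q => x q.1.1 * x q.2.2 = x q.1.2 * x q.2.1)
    simpa [Finset.card_product, hUbc] using this
  -- small n
  by_cases hn : n ≤ 2
  · have hk1 : k ≤ 1 := by omega
    have hT16 : (T.card : ℝ) ≤ 16 := by
      have h4 : 2 ^ k ≤ 2 := by
        calc 2 ^ k ≤ 2 ^ 1 := Nat.pow_le_pow_right (by norm_num) hk1
          _ = 2 := by norm_num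
      have h44 : 2 ^ k * 2 ^ k ≤ 4 := by nlinarith
      have : T.card ≤ 16 := hTtriv.trans (by nlinarith)
      exact_mod_cast this
    have hC0 : (0 : ℝ) ≤ 16 * C₉ ^ (1 / e) := by positivity
    calc (T.card : ℝ) ≤ 16 := hT16
      _ ≤ (16 * C₉ ^ (1 / e) + 32) * 1 := by linarith
      _ ≤ (16 * C₉ ^ (1 / e) + 32) * (2 : ℝ) ^ ((3 - 1 / e) * (k : ℝ)) :=
          mul_le_mul_of_nonneg_left hRHS1 (by positivity)
  -- p is odd
  have hp2 : p ≠ 2 := by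
    intro h
    have : 2 ^ 3 ≤ 2 ^ n := Nat.pow_le_pow_right (by norm_num) (by omega)
    omega
  -- fibres of x and the index-energy reduction
  have hfib : ∀ y, (Ub.filter fun u => x u = y).card ≤ 2 := by
    intro y
    have h := spread_fibre_le_two hp2 h2p b (c + (Nat.ofBits b : ZMod p)) y
    have hEq : (Ub.filter fun u => x u = y) =
        (Ub.filter fun u => c + (Nat.ofBits b : ZMod p) - 2 * (Nat.ofBits u : ZMod p) = y) :=
      Finset.filter_congr fun u _ => by simp only [hx, add_sub_assoc]
    rw [hEq]; exact h
  set S := Ub.image x with hS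
  set A := S.erase 0 with hA
  have hTE := index_energy_le Ub x hfib
  rw [← hT, ← hS, ← hA, hUbc] at hTE
  have hA0 : (0 : ZMod p) ∉ A := Finset.notMem_erase 0 S
  have hS2 : Ub.card ≤ 2 * S.card := Finset.card_le_mul_card_image Ub 2 fun y _ => hfib y
  have hAS1 : S.card ≤ A.card + 1 := by
    have := Finset.pred_card_le_card_erase (s := S) (a := (0 : ZMod p)); rw [← hA] at this; omega
  have hAN : A.card ≤ 2 ^ k :=
    (Finset.card_erase_le).trans (Finset.card_image_le.trans (le_of_eq hUbc))
  have hkA : 2 ^ k ≤ 2 * (A.card + 1) := by rw [← hUbc]; omega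
  have hEbound := spread_energy_bound hp2 h2p b c k hk.symm hb C₁ C₂ hC₂
    (fun A K => hBSG (ZMod p) A K) (fun A => hPD (ZMod p) A) A hA0 (Finset.erase_subset _ _) hAN hkA
  rw [← he, ← hC₉] at hEbound
  -- assemble
  have hpow_split : ∀ t : ℝ, ((2 : ℝ) ^ (k : ℝ)) ^ t = (2 : ℝ) ^ (t * (k : ℝ)) := by
    intro t; rw [← Real.rpow_mul h2pos.le]; ring_nf
  have hN2 : (2 : ℝ) ^ k * (2 : ℝ) ^ k ≤ (2 : ℝ) ^ ((3 - 1 / e) * (k : ℝ)) := by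
    have e2 : (2 : ℝ) ^ k * (2 : ℝ) ^ k = ((2 : ℝ) ^ (k : ℝ)) ^ (2 : ℝ) := by
      rw [Real.rpow_two, Real.rpow_natCast]; ring
    rw [e2, hpow_split]
    exact Real.rpow_le_rpow_of_exponent_le (by norm_num)
      (mul_le_mul_of_nonneg_right (by linarith) (Nat.cast_nonneg _))
  have hTR : (T.card : ℝ) ≤ 16 * (Finset.mulEnergy A A : ℝ) + 16 * ((2 : ℝ) ^ k * (2 : ℝ) ^ k) := by
    exact_mod_cast hTE
  calc (T.card : ℝ) ≤ 16 * (Finset.mulEnergy A A : ℝ) + 16 * ((2 : ℝ) ^ k * (2 : ℝ) ^ k) := hTR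
    _ ≤ 16 * (C₉ ^ (1 / e) * (2 : ℝ) ^ ((3 - 1 / e) * (k : ℝ))) +
        16 * (2 : ℝ) ^ ((3 - 1 / e) * (k : ℝ)) := by
        gcongr
    _ ≤ (16 * C₉ ^ (1 / e) + 32) * (2 : ℝ) ^ ((3 - 1 / e) * (k : ℝ)) := by
        have h0 : (0 : ℝ) ≤ (2 : ℝ) ^ ((3 - 1 / e) * (k : ℝ)) := by positivity
        have e1 : 16 * (C₉ ^ (1 / e) * (2 : ℝ) ^ ((3 - 1 / e) * (k : ℝ))) +
            16 * (2 : ℝ) ^ ((3 - 1 / e) * (k : ℝ)) =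
            (16 * C₉ ^ (1 / e) + 16) * (2 : ℝ) ^ ((3 - 1 / e) * (k : ℝ)) := by ring
        rw [e1]
        exact mul_le_mul_of_nonneg_right (by linarith) h0

end Summit.QuantumAdvantage.QuantumAdvantage.Theorems.SymplecticPurity
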